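import Mathlib.Tactic
import Literature.Computability.Complexity.PromisePolyExists
import Literature.Computability.Complexity.PromiseSIZE
import Literature.Computability.QuantumComplexity.SimUniformity
import Literature.Computability.Cryptography.ClassBQP
import Summits.QuantumAdvantage.QuantumAdvantage.Statement
import Summits.QuantumAdvantage.QuantumAdvantage.Theorems.SoloInformedPromiseSepIffSummit
import HarnessLib

/-!
# SoloInformedDoorFloor — the floor under the door: `Q-EXT` proves fixed-polynomial circuit lower bounds for `∃·BQP`

Solo seat `solo-QuantumAdvantage-informed` (ideation tier, summit-directed); new mathematics for the summit
`QuantumAdvantage := ∃ L, L ∈ BQP ∧ L ∉ BPP`, continuing the conditional door of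
`SoloInformedPseudoDeterministicLift` / `SoloInformedPromiseSepIffSummit`: under the quantum lift hypothesis
`Q-EXT := PromiseBQP ⊆ promiseLift BQP` ("every `PromiseBQP` problem is solved by a `BQP` language", the quantum
form of Dixon–Pavan–Vander Woude–Vinodchandran's "PromiseBPP has solutions in BPP ⟺ APEP is pseudo-deterministic")
the summit is EQUIVALENT to the promise separation `¬(PromiseBQP ⊆ PromiseBPP)`.

Session 1 showed `Q-EXT` is not summit-strength (it holds in every world `PP = BPP`, `SoloInformedPromiseLiftPP`).
This file puts a FLOOR under it, calibrated by a recognised open circuit lower bound — the quantum twin of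
DPVwV Thm. 2.2 ("APEP pseudo-deterministic ⟹ `MA ⊄ SIZE(nᵏ)`"):

* `PromiseBPP'_subset_PromiseBQP` — `pr-BPP ⊆ PromiseBQP` (Bernstein–Vazirani Thm. 8.3 at the promise level,
  from the tree's reversible simulation `uniformReversibleSimulation_holds` and `coinFamily_acceptProbOn`);
* `PromiseMA'_subset_prPolyExists_PromiseBQP` — `pr-MA ⊆ pr∃·PromiseBQP` (= promise-`QCMA`, Gharibian et al.
  Def. 2.2, up to the witness-length convention);
* `ofLanguage_mem_prQCMA_of_mem_polyExists_BQP` — every `∃·BQP` language is a promise-`QCMA` problem;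
* **the weakest door that carries the floor**, `H₀ := PromiseBPP' ⊆ promiseLift BQP` ("every `pr-BPP` problem is
  solved by some `BQP` LANGUAGE" — quantum algorithms canonise classical approximations), implied both by `Q-EXT`
  (`classicalPromisesLift_of_promiseIsLift`) and by DPVwV's classical hypothesis `PromiseBPP' ⊆ PromiseBPP`
  (`classicalPromisesLift_of_classicalLift`, as `BPP ⊆ BQP`);
* `MA_subset_polyExists_BQP_of_classicalPromisesLift` — `H₀ ⟹ MA ⊆ ∃·BQP` (compare Gharibian et al. Rem. 3.7:
  "`∃·BPP = MA` remains an open question");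
* `prQCMA_subset_promiseLift_polyExists_BQP_of_promiseIsLift` — `Q-EXT ⟹ pr-QCMA ⊆ promiseLift (∃·BQP)`: under
  the door every promise-`QCMA` problem is solved by an `∃·BQP` language (the witness operator commutes with
  the lift, `prPolyExists_subset_promiseLift_polyExists`);
* **`exists_polyExists_BQP_not_mem_SIZE_of_classicalPromisesLift`** — given Santhanam's theorem
  `pr-MA ⊄ SIZE(O(nᵏ))` as the named fact `santhanam_promiseMA_not_fixedPolySize`:
  `H₀ ⟹ ∀ k, ∃ L ∈ ∃·BQP, L ∉ ⋃_c SIZE(c·nᵏ + c)`; hence the same under `Q-EXT`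
  (`exists_polyExists_BQP_not_mem_SIZE_of_promiseIsLift`) and, classically, DPVwV Thm. 2.2 itself
  (`exists_polyExists_BPP_not_mem_SIZE_of_classicalLift`: `PromiseBPP' ⊆ PromiseBPP ⟹ ∃·BPP ⊄ SIZE(O(nᵏ))`);
* `doorFloor` — the package: under `Q-EXT`, (summit ⟺ promise separation) ∧ (`∃·BQP`, hence the language
  classes `QCMA ⊆ QMA` above it, has no fixed-polynomial-size circuits);
* **the classical door** `quantumAdvantage_of_classicalPromisesLift_of_not_classicalLift` —
  `H₀ ∧ ¬(PromiseBPP' ⊆ PromiseBPP) ⟹ QuantumAdvantage`: if quantum algorithms canonise classical acceptance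
  probabilities (`H₀`) but classical ones cannot (APEP is NOT pseudo-deterministic, DPVwV Thm. 2.1), then the
  `BQP` solution of the offending `pr-BPP` problem is a `BQP` language outside `BPP`; equivalently
  (`classicalPromisesLift_iff_classicalLift_of_not_quantumAdvantage`) in a world without quantum advantage the
  quantum and the classical canonisation hypotheses coincide, `H₀ ↔ (PromiseBPP' ⊆ PromiseBPP)`, just as
  `Q-EXT ↔ ¬PSep` there (session 1) — so `H₀ ⟹ QuantumAdvantage ∨ (PromiseBPP' ⊆ PromiseBPP)`
  (`quantumAdvantage_or_classicalLift_of_classicalPromisesLift`).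

Reading. `∃·BQP ⊆ QCMA ⊆ QMA ⊆ PP` as language classes; fixed-polynomial lower bounds are known for `PP`
(Vinodchandran; Aaronson) and for the PROMISE classes `pr-MA ⊆ pr-QCMA ⊆ pr-QMA` (Santhanam Thm. 14), but for
none of the semantic language classes `MA`, `∃·BQP`, `QCMA`, `QMA` (DPVwV §2: "Showing that `MA ⊄ SIZE(nᵏ)` for
any `k` is a significant open question"; searched corpus fts+vec and galaxy for "QMA"/"QCMA" with "SIZE(n^k)",
"fixed-polynomial", "Karp–Lipton": no result placing `QCMA` or `QMA` outside `SIZE(nᵏ)`). So any proof of the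
summit through the door `Q-EXT` — indeed any proof of the weaker `H₀` — is at least a proof of a new
fixed-polynomial circuit lower bound for a quantum Merlin–Arthur language class; and `H₀` is exactly where the
classical (DPVwV) and quantum doors meet.

[cite: DixonPavanVanderWoudeVinodchandran2022, Thm. 2.2, Thm. 5.1, Thm. 5.2] [cite: Santhanam2009, Thm. 14]
[cite: GharibianEtAl2022, Def. 2.2, Def. 3.6, Rem. 3.7] [cite: BernsteinVazirani1997, Thm. 8.3]
-/

noncomputable section

namespace Summit.QuantumAdvantage.QuantumAdvantage.Theorems

open _root_.Computability Literature.Computability.Complexity Literature.Computability.Cryptography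
  Literature.Computability.QuantumComplexity Literature.QuantumAdvantage

/-! ### `pr-BPP ⊆ PromiseBQP` and `pr-MA ⊆ pr-QCMA` -/

/-- **`pr-BPP ⊆ PromiseBQP`** (Bernstein–Vazirani Thm. 8.3 at the promise level). For `Q ∈ PromiseBPP'` with
decider `L' ∈ P` and coin polynomial `q`, the tree's uniform reversible Clifford+T simulation of `L'` run on
`|x⟩ ⊗ H^{⊗q|x|}|0⟩` accepts with probability exactly `Pr_{y ∈ {0,1}^{q|x|}}[⟨x, y⟩ ∈ L']`
(`coinFamily_acceptProbOn`), which is `≥ 2/3` on `Q.yes` and `≤ 1/3` on `Q.no`; nothing is claimed off the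
promise on either side. [cite: BernsteinVazirani1997, Thm. 8.3] [cite: Goldreich2006, Def. 1.2] -/
theorem PromiseBPP'_subset_PromiseBQP : PromiseBPP' ⊆ PromiseBQP := by
  classical
  intro Q hQ
  obtain ⟨L', hL'P, q, hyes, hno⟩ := hQ
  obtain ⟨m, D, out, hfree, hunif, hD, hinj, hout⟩ := uniformReversibleSimulation_holds L' hL'P q
  have hacc : ∀ x : List Bool, (coinFamily (fun n => q.eval n) m D).acceptProbOn 0 x =
      uniformProb (q.eval x.length) {y | boolPair x y ∈ L'} := by
    intro x
    rw [coinFamily_acceptProbOn hD hinj, uniformProb_eq_card_ofFn]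
    congr 2
    refine congrArg Finset.card (Finset.filter_congr fun y _ => ?_)
    rw [hout, List.ofFn_get, Set.mem_setOf_eq]
  refine ⟨coinFamily (fun n => q.eval n) m D, coinFamily_isOracleFree hfree, hunif, fun x hx => ?_,
    fun x hx => ?_⟩
  · rw [hacc]
    exact hyes x hx
  · have h := hno x hx
    have hE : {y : List Bool | boolPair x y ∉ L'} = {y : List Bool | boolPair x y ∈ L'}ᶜ := rfl
    rw [hE, Literature.Computability.Complexity.uniformProb_compl] at h
    rw [hacc]
    linarith

/-- A `BQP` language is, as a promise problem with trivial promise, in `PromiseBQP`: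
`ofLanguage '' BQP ⊆ PromiseBQP`. [cite: Watrous2009, §III.2] -/
theorem image_ofLanguage_BQP_subset_PromiseBQP : PromiseProblem.ofLanguage '' BQP ⊆ PromiseBQP := by
  rintro Q ⟨L, hL, rfl⟩
  exact ofLanguage_mem_PromiseBQP_iff.2 hL

/-- **`pr-MA ⊆ pr-QCMA`** (`pr∃·PromiseBQP`): a Merlin–Arthur protocol is a classical-witness quantum protocol
(`pr-MA ⊆ pr∃·pr-BPP`, and `pr-BPP ⊆ PromiseBQP`). [cite: GharibianEtAl2022, Def. 2.2 and Rem. 3.7] -/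
theorem PromiseMA'_subset_prPolyExists_PromiseBQP : PromiseMA' ⊆ prPolyExists PromiseBQP :=
  PromiseMA'_subset_prPolyExists_PromiseBPP'.trans (prPolyExists_mono PromiseBPP'_subset_PromiseBQP)

/-- **`∃·BQP` languages are promise-`QCMA` problems**: `L ∈ polyExists BQP ⟹ ofLanguage L ∈ pr∃·PromiseBQP`
(the `BQP` verifier of the inner language is a quantum verifier with bounded error on every pair).
[cite: GharibianEtAl2022, Def. 3.6 and Rem. 3.7] -/
theorem ofLanguage_mem_prQCMA_of_mem_polyExists_BQP {L : Language Bool} (hL : L ∈ polyExists BQP) :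
    PromiseProblem.ofLanguage L ∈ prPolyExists PromiseBQP :=
  prPolyExists_mono image_ofLanguage_BQP_subset_PromiseBQP (ofLanguage_mem_prPolyExists_iff.2 hL)

/-! ### The weakest door carrying the floor: `H₀ := pr-BPP ⊆ promiseLift BQP` -/

/-- `Q-EXT ⟹ H₀`: if every `PromiseBQP` problem is solved by a `BQP` language then so is every `pr-BPP` problem.
[cite: DixonPavanVanderWoudeVinodchandran2022, Thm. 2.1 (quantum analogue)] -/
theorem classicalPromisesLift_of_promiseIsLift (hExt : PromiseBQP ⊆ promiseLift BQP) :
    PromiseBPP' ⊆ promiseLift BQP :=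
  PromiseBPP'_subset_PromiseBQP.trans hExt

/-- DPVwV's hypothesis `⟹ H₀`: if every `pr-BPP` problem is solved by a `BPP` language (`PromiseBPP' ⊆ PromiseBPP`,
`PromiseBPP = promiseLift BPP`; ⟺ "APEP is pseudo-deterministic", DPVwV Thm. 2.1) then, as `BPP ⊆ BQP`, by a
`BQP` language. [cite: DixonPavanVanderWoudeVinodchandran2022, Thm. 2.1] -/
theorem classicalPromisesLift_of_classicalLift (hC : PromiseBPP' ⊆ PromiseBPP) :
    PromiseBPP' ⊆ promiseLift BQP :=
  hC.trans (promiseLift_mono fun _ hL => BPP_subset_BQP_holds hL)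

/-- **`H₀ ⟹ MA ⊆ ∃·BQP`**: if every `pr-BPP` problem is solved by a `BQP` language, every Merlin–Arthur language
is an `∃·BQP` language (witness operator commutes with the lift). Compare "`∃·BPP = MA` remains an open
question" (Gharibian et al. Rem. 3.7). [cite: DixonPavanVanderWoudeVinodchandran2022, Thm. 5.2] [cite: GharibianEtAl2022, Rem. 3.7] -/
theorem MA_subset_polyExists_BQP_of_classicalPromisesLift (h₀ : PromiseBPP' ⊆ promiseLift BQP) :
    MA ⊆ polyExists BQP :=
  MA_subset_polyExists_of_PromiseBPP'_subset_promiseLift h₀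

/-- `H₀ ⟹ pr-MA ⊆ promiseLift (∃·BQP)`: every `pr-MA` problem is solved by an `∃·BQP` language.
[cite: DixonPavanVanderWoudeVinodchandran2022, Thm. 5.1] -/
theorem PromiseMA'_subset_promiseLift_polyExists_BQP_of_classicalPromisesLift
    (h₀ : PromiseBPP' ⊆ promiseLift BQP) : PromiseMA' ⊆ promiseLift (polyExists BQP) :=
  PromiseMA'_subset_prPolyExists_PromiseBPP'.trans (prPolyExists_subset_promiseLift_polyExists h₀)

/-- **`Q-EXT ⟹ pr-QCMA ⊆ promiseLift (∃·BQP)`**: under the door, every promise-`QCMA` problem (`pr∃·PromiseBQP`)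
is solved by an `∃·BQP` language. [cite: GharibianEtAl2022, Def. 2.2 and Rem. 3.7] [cite: DixonPavanVanderWoudeVinodchandran2022, Thm. 5.1] -/
theorem prQCMA_subset_promiseLift_polyExists_BQP_of_promiseIsLift (hExt : PromiseBQP ⊆ promiseLift BQP) :
    prPolyExists PromiseBQP ⊆ promiseLift (polyExists BQP) :=
  prPolyExists_subset_promiseLift_polyExists hExt

/-- `Q-EXT ⟹ MA ⊆ ∃·BQP`. [cite: GharibianEtAl2022, Rem. 3.7] -/
theorem MA_subset_polyExists_BQP_of_promiseIsLift (hExt : PromiseBQP ⊆ promiseLift BQP) : MA ⊆ polyExists BQP :=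
  MA_subset_polyExists_BQP_of_classicalPromisesLift (classicalPromisesLift_of_promiseIsLift hExt)

/-! ### The floor: fixed-polynomial circuit lower bounds for `∃·BQP` -/

/-- **The floor under the weakest door.** Given Santhanam's theorem (`pr-MA ⊄ SIZE(O(nᵏ))`, named fact): if
every `pr-BPP` problem is solved by a `BQP` language, then for every `k` some `∃·BQP` language has no
`B₂`-circuits of size `c·nᵏ + c` for any `c` — a fixed-polynomial circuit lower bound for `∃·BQP ⊆ QCMA ⊆ QMA`,
known for none of these language classes. [cite: Santhanam2009, Thm. 14] [cite: DixonPavanVanderWoudeVinodchandran2022, Thm. 2.2 and Thm. 5.1] -/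
theorem exists_polyExists_BQP_not_mem_SIZE_of_classicalPromisesLift (hS : santhanam_promiseMA_not_fixedPolySize)
    (h₀ : PromiseBPP' ⊆ promiseLift BQP) (k : ℕ) :
    ∃ L ∈ polyExists BQP, L ∉ ⋃ c : ℕ, SIZE (fun n => c * n ^ k + c) :=
  exists_not_mem_SIZE_of_PromiseMA'_subset_promiseLift hS
    (PromiseMA'_subset_promiseLift_polyExists_BQP_of_classicalPromisesLift h₀) k

/-- **The floor under the door `Q-EXT`**: `PromiseBQP ⊆ promiseLift BQP ⟹ ∀ k, ∃ L ∈ ∃·BQP, L ∉ SIZE(O(nᵏ))`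
(given Santhanam's theorem). [cite: Santhanam2009, Thm. 14] [cite: DixonPavanVanderWoudeVinodchandran2022, Thm. 2.2 (quantum analogue)] -/
theorem exists_polyExists_BQP_not_mem_SIZE_of_promiseIsLift (hS : santhanam_promiseMA_not_fixedPolySize)
    (hExt : PromiseBQP ⊆ promiseLift BQP) (k : ℕ) :
    ∃ L ∈ polyExists BQP, L ∉ ⋃ c : ℕ, SIZE (fun n => c * n ^ k + c) :=
  exists_polyExists_BQP_not_mem_SIZE_of_classicalPromisesLift hS (classicalPromisesLift_of_promiseIsLift hExt) k

/-- **DPVwV Thm. 2.2 reproduced** (classical door): if every `pr-BPP` problem is solved by a `BPP` language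
("APEP is pseudo-deterministic") then `∀ k, ∃ L ∈ ∃·BPP, L ∉ SIZE(O(nᵏ))` — so `MA ⊇ ∃·BPP` has no
fixed-polynomial-size circuits (given Santhanam's theorem). [cite: DixonPavanVanderWoudeVinodchandran2022, Thm. 2.2 and Thm. 5.1] [cite: Santhanam2009, Thm. 14] -/
theorem exists_polyExists_BPP_not_mem_SIZE_of_classicalLift (hS : santhanam_promiseMA_not_fixedPolySize)
    (hC : PromiseBPP' ⊆ PromiseBPP) (k : ℕ) :
    ∃ L ∈ polyExists BPP, L ∉ ⋃ c : ℕ, SIZE (fun n => c * n ^ k + c) :=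
  exists_not_mem_SIZE_of_PromiseMA'_subset_promiseLift hS
    (PromiseMA'_subset_prPolyExists_PromiseBPP'.trans (prPolyExists_subset_promiseLift_polyExists hC)) k

/-- **Door and floor together.** Under `Q-EXT` (and Santhanam's theorem): the summit `QuantumAdvantage` is
equivalent to the promise separation `¬(PromiseBQP ⊆ PromiseBPP)` (session 1,
`quantumAdvantage_iff_promiseSep_of_promiseIsLift`), AND `∃·BQP` already has no fixed-polynomial-size
circuits — the price of the door is at least a Merlin–Arthur-type circuit lower bound for a quantum class.
[cite: DixonPavanVanderWoudeVinodchandran2022, Thm. 2.1 and Thm. 2.2] [cite: Santhanam2009, Thm. 14] -/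
theorem doorFloor (hS : santhanam_promiseMA_not_fixedPolySize) (hExt : PromiseBQP ⊆ promiseLift BQP) :
    (QuantumAdvantage ↔ ¬ PromiseBQP ⊆ PromiseBPP) ∧
      ∀ k : ℕ, ∃ L ∈ polyExists BQP, L ∉ ⋃ c : ℕ, SIZE (fun n => c * n ^ k + c) :=
  ⟨quantumAdvantage_iff_promiseSep_of_promiseIsLift hExt,
    exists_polyExists_BQP_not_mem_SIZE_of_promiseIsLift hS hExt⟩

/-! ### The classical door: `H₀ ∧ ¬C-EXT ⟹ summit` -/

/-- In a world without quantum advantage every `BQP` language is a `BPP` language. [folklore] -/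
theorem BQP_subset_BPP_of_not_quantumAdvantage (h : ¬ QuantumAdvantage) : BQP ⊆ BPP := by
  intro L hL
  by_contra hLB
  exact h ⟨L, hL, hLB⟩

/-- **The classical door.** If every `pr-BPP` problem is solved by a `BQP` language (`H₀`) but NOT every
`pr-BPP` problem is solved by a `BPP` language (APEP is not pseudo-deterministic, DPVwV Thm. 2.1;
`PromiseBPP = promiseLift BPP`), then `BQP ⊄ BPP`: the `BQP` solution of the offending problem is the witness.
[cite: DixonPavanVanderWoudeVinodchandran2022, Thm. 2.1] -/
theorem quantumAdvantage_of_classicalPromisesLift_of_not_classicalLift (h₀ : PromiseBPP' ⊆ promiseLift BQP)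
    (hn : ¬ PromiseBPP' ⊆ PromiseBPP) : QuantumAdvantage := by
  by_contra hQA
  exact hn (h₀.trans (promiseLift_mono (BQP_subset_BPP_of_not_quantumAdvantage hQA)))

/-- `H₀ ⟹ QuantumAdvantage ∨ C-EXT`: quantum canonisation of classical acceptance probabilities gives either
the summit or classical pseudo-determinism of APEP (with all its DPVwV consequences: `MA` circuit lower
bounds, `BPP` hierarchies, …). [cite: DixonPavanVanderWoudeVinodchandran2022, Thm. 2.1 and Thm. 2.2] -/
theorem quantumAdvantage_or_classicalLift_of_classicalPromisesLift (h₀ : PromiseBPP' ⊆ promiseLift BQP) :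
    QuantumAdvantage ∨ PromiseBPP' ⊆ PromiseBPP := by
  by_cases hC : PromiseBPP' ⊆ PromiseBPP
  · exact Or.inr hC
  · exact Or.inl (quantumAdvantage_of_classicalPromisesLift_of_not_classicalLift h₀ hC)

/-- **Without quantum advantage the two canonisation hypotheses coincide**: `¬QuantumAdvantage ⟹
(H₀ ↔ PromiseBPP' ⊆ PromiseBPP)` — quantum pseudo-determinism of APEP is then the same statement as classical
pseudo-determinism of APEP (compare session 1: `¬QuantumAdvantage ⟹ (Q-EXT ↔ ¬PSep)`). So a proof of `H₀` that
is not also a proof of DPVwV's hypothesis is a proof of the summit (pointwise: one `pr-BPP` problem in the window `promiseLift BQP ∖ PromiseBPP` suffices,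
session 1 `quantumAdvantage_iff_exists_window`). [cite: DixonPavanVanderWoudeVinodchandran2022, Thm. 2.1] -/
theorem classicalPromisesLift_iff_classicalLift_of_not_quantumAdvantage (h : ¬ QuantumAdvantage) :
    PromiseBPP' ⊆ promiseLift BQP ↔ PromiseBPP' ⊆ PromiseBPP :=
  ⟨fun h₀ => (quantumAdvantage_or_classicalLift_of_classicalPromisesLift h₀).resolve_left h,
    classicalPromisesLift_of_classicalLift⟩

end Summit.QuantumAdvantage.QuantumAdvantage.Theorems

end
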